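import Summits.Ventures.WeilGRH.KeySectionBoxCover
import Summits.Ventures.WeilGRH.KeySectionToTest
import HarnessLib

/-!
# C-VII packaged, arithmetic regime: a finite COVER of real sections bounds the margin of every covered key

Cell `rh-explicit`, WEIL TRACK — GRH ARM (weil-grh-5; `GRH-LIT-AS-PRINTED.md` A31/A33).  Above the entry of
the prime `5` the GRH-edge maximum principle (STRUCTURE.md C-VII, pen weil-grh-4) is certified by weil-grh-4's
MULTI-STATE «arith-patch» certificates (G34: at `log 2` 1 225 states / 18 528 boxes, at `4023/5000` 325 / 4 656,
at `9/10`, `1`): finitely many real trigonometric sections `u_j = Σ x_{j,n} χ_n` on `[-b, b]`, each with a box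
`box j` of phase data on which the affine key form of `u_j` is bounded by `m j`, a common Rayleigh bound `B`
(`keyMarkovForm a L 0 b u_j − m j ≤ B‖u_j‖₂²`), and a COVER of the admissible data `P` by the boxes.  The typed
shape is `keyStates_cover_le_chi` (KeySectionBoxCover): every covered datum `v` has SOME state with section
Rayleigh value `≤ B`.  This file composes it with the section → test transfer (`keyMargin_le_of_isWindowFunction`,
KeySectionToTest) into the statements the certificates are booked against:

* `keyMargin_le_of_states_cover` — for every covered datum `v` and every window `t_{N'} = log(N'+1)/2 > b`:
  any `c` with `c‖h‖₂² ≤ E_{a,L,v,N'}(h)` for all test functions `h` on `[−t_{N'}, t_{N'}]` satisfies `c ≤ B`;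
* `charMargin_le_of_states_cover` — for a Dirichlet character `χ` mod `q ≠ 1` of parity `a` whose values are
  covered (`P (χ ·)`): `c‖h‖₂² ≤ Re Q_χ(h)` on that window forces `c ≤ B + (log q − L)`.

Everything is proved; no definitions, no named facts, RH/GRH-free; the states, boxes, bounds and the cover are the
instance's (weil-grh-4's G34 deposits, kit-certified).  [cite: Weil1952FormulesExplicites, (11) pp. 261–262;
Bombieri2000Weil, Thm 2 p. 193 and §4 Problem 2; Yoshida1992, §5 (5.13)–(5.16)]
-/

set_option autoImplicit false

noncomputable section

open Complex Filter Set MeasureTheory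
open scoped Real Topology ComplexConjugate ArithmeticFunction.vonMangoldt

namespace Summit.Ventures.WeilGRH

open Literature.NumberTheory.LFunctions
open Literature.NumberTheory.LFunctions.Yoshida1992 (modes chi chiCore mem_modes)
open Summit.RiemannHypothesis.RiemannHypothesis.Theorems.WeilFormatC

variable {b : ℝ} {q : ℕ}

/-- **Multi-state principle ⇒ margins (key form).**  `0 < b < t_{N'} = log(N'+1)/2`; states `u_j = Σ_{|n|≤N} x_{j,n}χ_n`
(`j ∈ J`, real: `x_j(−n) = conj x_j(n)`, each `≠ 0`), boxes `box j` with affine bounds `m j` on the spikes of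
`u_j` (`hm`), certified Rayleigh bounds `keyMarkovForm a L 0 b u_j − m j ≤ B Σ|x_{j,n}|²` (`hcert`), and a cover of
the admissible data `P` by the boxes (`hcover`).  Then for every `v` with `P v`: any `c` with
`c‖h‖₂² ≤ E_{a,L,v,N'}(h)` for all test functions `h` on `[−t_{N'}, t_{N'}]` satisfies `c ≤ B`. [folklore] -/
theorem keyMargin_le_of_states_cover (hb : 0 < b) (N : ℕ) {ι : Type*} (J : Finset ι) (x : ι → ℤ → ℂ)
    (hx : ∀ j ∈ J, ∀ n, x j (-n) = conj (x j n)) (hx0 : ∀ j ∈ J, 0 < ∑ n ∈ modes N, ‖x j n‖ ^ 2)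
    (box : ι → (ℕ → ℂ) → Prop) (m : ι → ℝ) {a : ℕ} (ha : a ≤ 1) (L : ℝ) {B : ℝ}
    (hm : ∀ j ∈ J, ∀ v, box j v → m j ≤ ∑ n ∈ weilPrimeIndex b,
      (Λ n : ℝ) / Real.sqrt n * (2 * (weilConv (∑ k ∈ modes N, x j k • chi b k)
        (weilReflect (∑ k ∈ modes N, x j k • chi b k)) (Real.log n)).re) * (v n).re)
    (hcert : ∀ j ∈ J, keyMarkovForm a L 0 b (∑ k ∈ modes N, x j k • chi b k) - m j ≤ B * ∑ n ∈ modes N, ‖x j n‖ ^ 2)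
    {P : (ℕ → ℂ) → Prop} (hcover : ∀ v, P v → ∃ j ∈ J, box j v)
    {N' : ℕ} (hbN : b < Real.log ((N' : ℝ) + 1) / 2)
    {v : ℕ → ℂ} (hv : P v) {c : ℝ}
    (hc : ∀ h : ℝ → ℂ, IsWeilTest h →
      tsupport h ⊆ Icc (-(Real.log ((N' : ℝ) + 1) / 2)) (Real.log ((N' : ℝ) + 1) / 2) →
      c * weilNorm2Sq h ≤ weilFinitePrimeQuadraticKey a L v N' h) :
    c ≤ B := by
  obtain ⟨j, hj, hle⟩ := keyStates_cover_le_chi hb N J x hx box m a L hm hcert hcover hv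
  set u : ℝ → ℂ := ∑ k ∈ modes N, x j k • chi b k with hu_def
  have hu : IsWindowFunction b u := IsWindowFunction.sum (modes N) (x j) fun n _ ↦ isWindowFunction_chi hb n
  have hnorm : ∫ y, ‖u y‖ ^ 2 = ∑ n ∈ modes N, ‖x j n‖ ^ 2 := integral_norm_sq_sum_smul_chi hb (modes N) (x j)
  have hBv : keyMarkovForm a L v b u ≤ B * ∫ y, ‖u y‖ ^ 2 := by
    rw [hnorm, hu_def, keyMarkovForm_sum_smul_chi hb (modes N) (x j) a L v]
    exact hle
  have hu0 : 0 < ∫ y, ‖u y‖ ^ 2 := by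
    rw [hnorm]
    exact hx0 j hj
  have hBv' : keyMarkovForm a L v (Real.log ((N' : ℝ) + 1) / 2) u ≤ B * ∫ y, ‖u y‖ ^ 2 := by
    rwa [keyMarkovForm_window_eq_of_isWindowFunction hu hbN.le]
  exact keyMargin_le_of_isWindowFunction hb.le hu hbN ha L v hu0 hBv' hc

/-- **Multi-state principle ⇒ margins (character form).**  Same states / boxes / bounds / cover.  For a Dirichlet
character `χ` mod `q ≠ 1` of parity `a` whose datum `n ↦ χ(n)` is covered (`P`): if `c‖h‖₂² ≤ Re Q_χ(h)` for every
test function `h` on `[−t_{N'}, t_{N'}]` (`b < t_{N'}`), then `c ≤ B + (log q − L)` — «margin(χ) ≤ B + log(q/q₀)»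
when the certificate is run at `L = log q₀`. [folklore] -/
theorem charMargin_le_of_states_cover (hb : 0 < b) (N : ℕ) {ι : Type*} (J : Finset ι) (x : ι → ℤ → ℂ)
    (hx : ∀ j ∈ J, ∀ n, x j (-n) = conj (x j n)) (hx0 : ∀ j ∈ J, 0 < ∑ n ∈ modes N, ‖x j n‖ ^ 2)
    (box : ι → (ℕ → ℂ) → Prop) (m : ι → ℝ) {a : ℕ} (ha : a ≤ 1) (L : ℝ) {B : ℝ}
    (hm : ∀ j ∈ J, ∀ v, box j v → m j ≤ ∑ n ∈ weilPrimeIndex b,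
      (Λ n : ℝ) / Real.sqrt n * (2 * (weilConv (∑ k ∈ modes N, x j k • chi b k)
        (weilReflect (∑ k ∈ modes N, x j k • chi b k)) (Real.log n)).re) * (v n).re)
    (hcert : ∀ j ∈ J, keyMarkovForm a L 0 b (∑ k ∈ modes N, x j k • chi b k) - m j ≤ B * ∑ n ∈ modes N, ‖x j n‖ ^ 2)
    {P : (ℕ → ℂ) → Prop} (hcover : ∀ v, P v → ∃ j ∈ J, box j v)
    {N' : ℕ} (hbN : b < Real.log ((N' : ℝ) + 1) / 2)
    (hq : q ≠ 1) (χ : DirichletCharacter ℂ q) (hχa : charParity χ = a) (hv : P fun n ↦ χ (n : ZMod q))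
    {c : ℝ} (hc : ∀ h : ℝ → ℂ, IsWeilTest h →
      tsupport h ⊆ Icc (-(Real.log ((N' : ℝ) + 1) / 2)) (Real.log ((N' : ℝ) + 1) / 2) →
      c * weilNorm2Sq h ≤ (weilQuadraticChar χ h).re) :
    c ≤ B + (Real.log q - L) := by
  have hN : Real.exp (2 * (Real.log ((N' : ℝ) + 1) / 2)) ≤ (N' : ℝ) + 1 := by
    rw [mul_div_cancel₀ _ two_ne_zero, Real.exp_log (by positivity)]
  have hc' : ∀ h : ℝ → ℂ, IsWeilTest h →
      tsupport h ⊆ Icc (-(Real.log ((N' : ℝ) + 1) / 2)) (Real.log ((N' : ℝ) + 1) / 2) →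
      (c - (Real.log q - L)) * weilNorm2Sq h ≤
        weilFinitePrimeQuadraticKey a L (fun n ↦ χ (n : ZMod q)) N' h := by
    intro h hh hs
    have h1 := hc h hh hs
    rw [re_weilQuadraticChar_eq_keyMarkovForm hq χ hh hs, hχa,
      keyMarkovForm_eq_weilFinitePrimeQuadraticKey hh hs hN ha (Real.log q) (fun n ↦ χ (n : ZMod q)),
      weilFinitePrimeQuadraticKey_eq_add_norm hh a L (Real.log q) _ N'] at h1
    rw [sub_mul]
    linarith
  have key := keyMargin_le_of_states_cover hb N J x hx hx0 box m ha L hm hcert hcover hbN hv hc'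
  linarith

end Summit.Ventures.WeilGRH

end
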